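import Literature.IUT.LogVolume.TameRadicalIsometryStable
import HarnessLib

/-!
# The tame radical packet `K ⊗_{ℚ_p} K` as a cyclic convolution ring (any `p`, any `e ≥ 1`)

Classical local algebra (nothing disputed; the [IUTchIV] locator records where the abc-iut cell uses it).
`K` is an ultrametric normed field over `ℚ_p` with `π ∈ K`, `π^e = p`, `e ≥ 1`; when `[K : ℚ_p] = e`, `K = ℚ_p(p^{1/e})`.
`TameRadicalIsometryStable` writes every `z ∈ K ⊗_{ℚ_p} K` as `Σ_{k<e} π^k ⊗ l_k` and identifies the maximal order
`(R_I)^∼` ([IUTchIV] Prop. 1.1, campaign-S `normalizedPacket`) with the «valuation box» `{∀ k, ‖π^k·l_k‖ ≤ 1}` WHEN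
`e ∣ p − 1`, via the field factors and discrete Fourier inversion over `μ_e(ℚ_p)`.  This file is the `ζ`-FREE toolkit
for the second rung (`p ∤ e` arbitrary, no roots of unity anywhere): in the coordinates `(l_k)` the ring `K ⊗_{ℚ_p} K` is
the CYCLIC CONVOLUTION ring `K[ℤ/e]` —

* `purePacket_pi_pow_reduce` — `π^n ⊗ w = π^{n mod e} ⊗ p^{⌊n/e⌋}·w` (`π^e = p` is a `ℚ_p`-scalar and crosses the `⊗`);
* `sum_purePacket_mul` — `(Σ_i π^i ⊗ l_i)·(Σ_j π^j ⊗ m_j) = Σ_k π^k ⊗ (l ⋆ m)_k`,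
  `(l ⋆ m)_k = Σ_{i+j ≡ k (e)} p^{⌊(i+j)/e⌋}·l_i m_j`, with `‖π^k (l ⋆ m)_k‖ ≤ (max_i ‖π^i l_i‖)·(max_j ‖π^j m_j‖)`
  (`norm_pi_pow_mul_conv_le`: the box norm is SUBMULTIPLICATIVE);
* `exists_coordFunctional`, `eq_of_sum_purePacket_eq` — the coordinates `l_k` are unique (`[K : ℚ_p] = e`);
* `iota_one_mul_sum_purePacket` — `ι₁(c)·Σ_k π^k ⊗ l_k = Σ_k π^k ⊗ c·l_k` (the box norm is `ι₁(K)`-homogeneous);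
* `exists_box_repr_of_mem_integerPacket` — **`R_I = 𝒪_K ⊗ 𝒪_K` lies in the box** (any `p`, `e`);
* `exists_box_repr_pow` — powers: `(Σ π^k ⊗ l_k)^n` has box norm `≤ M^n` if the original has box norm `≤ M`.

Consumed by `TameRadicalIsometryStableCoprime.lean` (the box is integrally closed iff `p ∤ e`, by Frobenius).
Proof-only file (theorems, no definitions). [cite: Mochizuki2012, IUTchIV Prop. 1.1 p. 9] [cite: NeukirchANT1999, Ch. II (5.5)]
-/

noncomputable section

open Metric Set
open scoped TensorProduct

namespace Literature.IUT.LogVolume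

namespace TameRadical

variable {p : ℕ} [Fact p.Prime]
variable {K : Type} [NontriviallyNormedField K] [NormedAlgebra ℚ_[p] K] {π : K} {e : ℕ}

/-! ## Pure tensors `x ⊗ y`: products, zero, negation, the unit, `ι₁`-homogeneity -/

/-- `(x ⊗ y)·(x' ⊗ y') = xx' ⊗ yy'`. [cite: Mochizuki2012, IUTchIV Prop. 1.1 p. 9] -/
theorem purePacket_pair_mul (p : ℕ) [Fact p.Prime] [NormedAlgebra ℚ_[p] K] (x y x' y' : K) :
    purePacket p (fun _ : Fin 2 => K) ![x, y] * purePacket p (fun _ : Fin 2 => K) ![x', y'] =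
      purePacket p (fun _ : Fin 2 => K) ![x * x', y * y'] := by
  rw [purePacket_mul]
  congr 1; funext i; fin_cases i <;> rfl

/-- `x ⊗ 0 = 0`. [cite: Mochizuki2012, IUTchIV Prop. 1.1 p. 9] -/
theorem purePacket_pair_zero_right (p : ℕ) [Fact p.Prime] [NormedAlgebra ℚ_[p] K] (x : K) :
    purePacket p (fun _ : Fin 2 => K) ![x, 0] = 0 := by
  rw [TameQuadratic.purePacket_pair_eq_iota_mul p, map_zero, mul_zero]

/-- `x ⊗ (−y) = −(x ⊗ y)`. [cite: Mochizuki2012, IUTchIV Prop. 1.1 p. 9] -/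
theorem purePacket_pair_neg_right (p : ℕ) [Fact p.Prime] [NormedAlgebra ℚ_[p] K] (x y : K) :
    purePacket p (fun _ : Fin 2 => K) ![x, -y] = -purePacket p (fun _ : Fin 2 => K) ![x, y] := by
  rw [TameQuadratic.purePacket_pair_eq_iota_mul p, TameQuadratic.purePacket_pair_eq_iota_mul p, map_neg, mul_neg]

/-- `1 ⊗ 1 = 1`. [cite: Mochizuki2012, IUTchIV Prop. 1.1 p. 9] -/
theorem purePacket_pair_one (p : ℕ) [Fact p.Prime] [NormedAlgebra ℚ_[p] K] :
    purePacket p (fun _ : Fin 2 => K) ![1, 1] = 1 := by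
  rw [← purePacket_one p (fun _ : Fin 2 => K)]
  congr 1; funext i; fin_cases i <;> rfl

/-- **`ι₁`-homogeneity**: `ι₁(c)·(x ⊗ y) = x ⊗ c·y`. [cite: Mochizuki2012, IUTchIV Prop. 1.1 p. 9] -/
theorem iota_one_mul_purePacket_pair (p : ℕ) [Fact p.Prime] [NormedAlgebra ℚ_[p] K] (c x y : K) :
    iota p (fun _ : Fin 2 => K) 1 c * purePacket p (fun _ : Fin 2 => K) ![x, y] =
      purePacket p (fun _ : Fin 2 => K) ![x, c * y] := by
  rw [TameQuadratic.purePacket_pair_eq_iota_mul p, TameQuadratic.purePacket_pair_eq_iota_mul p, map_mul,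
    mul_left_comm]

/-- The natural number `p`, as an element of `K ⊗ K`, is `ι₁(p)`. [cite: Mochizuki2012, IUTchIV Prop. 1.1 p. 9] -/
theorem natCast_eq_iota_one (p : ℕ) [Fact p.Prime] [NormedAlgebra ℚ_[p] K] (n : ℕ) :
    (n : PacketAlgebra p (fun _ : Fin 2 => K)) = iota p (fun _ : Fin 2 => K) 1 (n : K) := by
  rw [map_natCast]

/-! ## The monomials `π^n ⊗ w`: multiplication and reduction of the exponent modulo `e` -/

/-- `(π^a ⊗ w)·(π^b ⊗ w') = π^{a+b} ⊗ ww'`. [cite: Mochizuki2012, IUTchIV Prop. 1.1 p. 9] -/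
theorem purePacket_pi_pow_mul (p : ℕ) [Fact p.Prime] [NormedAlgebra ℚ_[p] K] (a b : ℕ) (w w' : K) :
    purePacket p (fun _ : Fin 2 => K) ![π ^ a, w] * purePacket p (fun _ : Fin 2 => K) ![π ^ b, w'] =
      purePacket p (fun _ : Fin 2 => K) ![π ^ (a + b), w * w'] := by
  rw [purePacket_pair_mul p, pow_add]

omit [Fact p.Prime] [NormedAlgebra ℚ_[p] K] in
/-- `π^n = p^{⌊n/e⌋}·π^{n mod e}` (`π^e = p`). [cite: NeukirchANT1999, Ch. II (5.5)] -/
theorem pi_pow_eq_natCast_pow_mul (hπ : π ^ e = (p : K)) (n : ℕ) :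
    π ^ n = (p : K) ^ (n / e) * π ^ (n % e) := by
  conv_lhs => rw [← Nat.div_add_mod n e]
  rw [pow_add, pow_mul, hπ]

/-- **Reduction of the exponent**: `π^n ⊗ w = π^{n mod e} ⊗ p^{⌊n/e⌋}·w` (the `ℚ_p`-scalar `p^{⌊n/e⌋}` crosses the
tensor sign). [cite: Mochizuki2012, IUTchIV Prop. 1.1 p. 9] -/
theorem purePacket_pi_pow_reduce (hπ : π ^ e = (p : K)) (n : ℕ) (w : K) :
    purePacket p (fun _ : Fin 2 => K) ![π ^ n, w] =
      purePacket p (fun _ : Fin 2 => K) ![π ^ (n % e), (p : K) ^ (n / e) * w] := by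
  have h1 : (p : K) ^ (n / e) = algebraMap ℚ_[p] K ((p : ℚ_[p]) ^ (n / e)) := by
    rw [map_pow, map_natCast]
  rw [pi_pow_eq_natCast_pow_mul hπ n, h1, ← Algebra.smul_def, TameQuadratic.purePacket_pair_smul_left,
    Algebra.smul_def]

omit [Fact p.Prime] [NormedAlgebra ℚ_[p] K] in
/-- The absolute value is unchanged by the reduction: `‖π^{n mod e}·(p^{⌊n/e⌋}·w)‖ = ‖π^n·w‖`.
[cite: NeukirchANT1999, Ch. II (5.5)] -/
theorem norm_pi_pow_mod_mul (hπ : π ^ e = (p : K)) (n : ℕ) (w : K) :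
    ‖π ^ (n % e) * ((p : K) ^ (n / e) * w)‖ = ‖π ^ n * w‖ := by
  rw [← mul_assoc, mul_comm (π ^ (n % e)), ← pi_pow_eq_natCast_pow_mul hπ n]

/-! ## Sums `Σ_{k<e} π^k ⊗ l_k`: additivity, regrouping, the unit, single monomials -/

/-- `Σ_k π^k ⊗ (l_k + l'_k) = Σ_k π^k ⊗ l_k + Σ_k π^k ⊗ l'_k`. [cite: Mochizuki2012, IUTchIV Prop. 1.1 p. 9] -/
theorem sum_purePacket_add (p : ℕ) [Fact p.Prime] [NormedAlgebra ℚ_[p] K] (l l' : Fin e → K) :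
    ∑ k : Fin e, purePacket p (fun _ : Fin 2 => K) ![π ^ (k : ℕ), (l + l') k] =
      ∑ k : Fin e, purePacket p (fun _ : Fin 2 => K) ![π ^ (k : ℕ), l k] +
        ∑ k : Fin e, purePacket p (fun _ : Fin 2 => K) ![π ^ (k : ℕ), l' k] := by
  rw [← Finset.sum_add_distrib]
  exact Finset.sum_congr rfl fun k _ => by rw [Pi.add_apply, TameQuadratic.purePacket_pair_add_right p]

/-- `Σ_k π^k ⊗ (−l_k) = −Σ_k π^k ⊗ l_k`. [cite: Mochizuki2012, IUTchIV Prop. 1.1 p. 9] -/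
theorem sum_purePacket_neg (p : ℕ) [Fact p.Prime] [NormedAlgebra ℚ_[p] K] (l : Fin e → K) :
    ∑ k : Fin e, purePacket p (fun _ : Fin 2 => K) ![π ^ (k : ℕ), (-l) k] =
      -∑ k : Fin e, purePacket p (fun _ : Fin 2 => K) ![π ^ (k : ℕ), l k] := by
  rw [← Finset.sum_neg_distrib]
  exact Finset.sum_congr rfl fun k _ => by rw [Pi.neg_apply, purePacket_pair_neg_right p]

/-- `Σ_k π^k ⊗ 0 = 0`. [cite: Mochizuki2012, IUTchIV Prop. 1.1 p. 9] -/
theorem sum_purePacket_zero (p : ℕ) [Fact p.Prime] [NormedAlgebra ℚ_[p] K] :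
    ∑ k : Fin e, purePacket p (fun _ : Fin 2 => K) ![π ^ (k : ℕ), (0 : Fin e → K) k] = 0 :=
  Finset.sum_eq_zero fun k _ => by rw [Pi.zero_apply, purePacket_pair_zero_right p]

/-- Finite sums of coordinate vectors: `Σ_k π^k ⊗ (Σ_x f_x)_k = Σ_x Σ_k π^k ⊗ (f_x)_k`.
[cite: Mochizuki2012, IUTchIV Prop. 1.1 p. 9] -/
theorem sum_purePacket_finset_sum (p : ℕ) [Fact p.Prime] [NormedAlgebra ℚ_[p] K] {ι : Type*} (s : Finset ι)
    (f : ι → Fin e → K) :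
    ∑ k : Fin e, purePacket p (fun _ : Fin 2 => K) ![π ^ (k : ℕ), (∑ x ∈ s, f x) k] =
      ∑ x ∈ s, ∑ k : Fin e, purePacket p (fun _ : Fin 2 => K) ![π ^ (k : ℕ), f x k] := by
  rw [Finset.sum_comm]
  exact Finset.sum_congr rfl fun k _ => by rw [Finset.sum_apply, purePacket_pair_sum_right p]

/-- **Regrouping by the exponent**: a sum of monomials `π^{f(x)} ⊗ c_x` with all `f(x) < e` is `Σ_{k<e} π^k ⊗ l_k` with
`l_k = Σ_{f(x) = k} c_x`. [cite: Mochizuki2012, IUTchIV Prop. 1.1 p. 9] -/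
theorem sum_purePacket_regroup (p : ℕ) [Fact p.Prime] [NormedAlgebra ℚ_[p] K] {ι : Type*} (s : Finset ι)
    (f : ι → ℕ) (hf : ∀ x ∈ s, f x < e) (c : ι → K) :
    ∑ x ∈ s, purePacket p (fun _ : Fin 2 => K) ![π ^ f x, c x] =
      ∑ k : Fin e, purePacket p (fun _ : Fin 2 => K)
        ![π ^ (k : ℕ), ∑ x ∈ s, if f x = (k : ℕ) then c x else 0] := by
  classical
  have h1 : ∀ k : Fin e, purePacket p (fun _ : Fin 2 => K) ![π ^ (k : ℕ), ∑ x ∈ s, if f x = (k : ℕ) then c x else 0] =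
      ∑ x ∈ s, if f x = (k : ℕ) then purePacket p (fun _ : Fin 2 => K) ![π ^ (k : ℕ), c x] else 0 := by
    intro k
    rw [purePacket_pair_sum_right p]
    refine Finset.sum_congr rfl fun x _ => ?_
    split_ifs
    · rfl
    · exact purePacket_pair_zero_right p _
  rw [Finset.sum_congr rfl fun k _ => h1 k, Finset.sum_comm]
  refine Finset.sum_congr rfl fun x hx => ?_
  rw [Finset.sum_eq_single (⟨f x, hf x hx⟩ : Fin e)]
  · rw [if_pos rfl]
  · intro k _ hk
    rw [if_neg]
    intro h
    exact hk (Fin.ext h.symm)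
  · intro h; exact absurd (Finset.mem_univ _) h

/-- A single monomial as a coordinate sum: `π^k ⊗ w = Σ_j π^j ⊗ (δ_{jk}·w)`. [cite: Mochizuki2012, IUTchIV Prop. 1.1 p. 9] -/
theorem purePacket_pi_pow_eq_sum (p : ℕ) [Fact p.Prime] [NormedAlgebra ℚ_[p] K] (k : Fin e) (w : K) :
    purePacket p (fun _ : Fin 2 => K) ![π ^ (k : ℕ), w] =
      ∑ j : Fin e, purePacket p (fun _ : Fin 2 => K) ![π ^ (j : ℕ), if j = k then w else 0] := by
  classical
  rw [Finset.sum_eq_single k]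
  · rw [if_pos rfl]
  · intro j _ hj; rw [if_neg hj, purePacket_pair_zero_right p]
  · intro h; exact absurd (Finset.mem_univ _) h

/-- The unit: `1 = Σ_k π^k ⊗ δ_{k0}` (`e ≥ 1`). [cite: Mochizuki2012, IUTchIV Prop. 1.1 p. 9] -/
theorem one_eq_sum_purePacket (p : ℕ) [Fact p.Prime] [NormedAlgebra ℚ_[p] K] (he : 0 < e) :
    (1 : PacketAlgebra p (fun _ : Fin 2 => K)) =
      ∑ j : Fin e, purePacket p (fun _ : Fin 2 => K) ![π ^ (j : ℕ), if j = ⟨0, he⟩ then 1 else 0] := by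
  rw [← purePacket_pi_pow_eq_sum p ⟨0, he⟩ (1 : K)]
  show (1 : PacketAlgebra p (fun _ : Fin 2 => K)) = purePacket p (fun _ : Fin 2 => K) ![π ^ 0, 1]
  rw [pow_zero, purePacket_pair_one p]

/-- `ι₁(c)·Σ_k π^k ⊗ l_k = Σ_k π^k ⊗ c·l_k`. [cite: Mochizuki2012, IUTchIV Prop. 1.1 p. 9] -/
theorem iota_one_mul_sum_purePacket (p : ℕ) [Fact p.Prime] [NormedAlgebra ℚ_[p] K] (c : K) (l : Fin e → K) :
    iota p (fun _ : Fin 2 => K) 1 c * ∑ k : Fin e, purePacket p (fun _ : Fin 2 => K) ![π ^ (k : ℕ), l k] =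
      ∑ k : Fin e, purePacket p (fun _ : Fin 2 => K) ![π ^ (k : ℕ), c * l k] := by
  rw [Finset.mul_sum]
  exact Finset.sum_congr rfl fun k _ => iota_one_mul_purePacket_pair p c _ _

/-! ## The product: cyclic convolution -/

/-- **`K ⊗_{ℚ_p} K` IS THE CYCLIC CONVOLUTION RING `K[ℤ/e]` in the coordinates `(l_k)`**:
`(Σ_i π^i ⊗ l_i)·(Σ_j π^j ⊗ m_j) = Σ_k π^k ⊗ (l ⋆ m)_k`, `(l ⋆ m)_k = Σ_{i+j ≡ k (mod e)} p^{⌊(i+j)/e⌋}·l_i·m_j`.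
[cite: Mochizuki2012, IUTchIV Prop. 1.1 p. 9] -/
theorem sum_purePacket_mul (he : 0 < e) (hπ : π ^ e = (p : K)) (l m : Fin e → K) :
    (∑ i : Fin e, purePacket p (fun _ : Fin 2 => K) ![π ^ (i : ℕ), l i]) *
        ∑ j : Fin e, purePacket p (fun _ : Fin 2 => K) ![π ^ (j : ℕ), m j] =
      ∑ k : Fin e, purePacket p (fun _ : Fin 2 => K) ![π ^ (k : ℕ),
        ∑ x : Fin e × Fin e, if ((x.1 : ℕ) + x.2) % e = (k : ℕ) then
          (p : K) ^ (((x.1 : ℕ) + x.2) / e) * (l x.1 * m x.2) else 0] := by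
  rw [Finset.sum_mul_sum, ← Finset.sum_product', Finset.univ_product_univ]
  rw [← sum_purePacket_regroup p Finset.univ (fun x : Fin e × Fin e => ((x.1 : ℕ) + x.2) % e)
    (fun x _ => Nat.mod_lt _ he)]
  exact Finset.sum_congr rfl fun x _ => by rw [purePacket_pi_pow_mul p, purePacket_pi_pow_reduce hπ]

omit [Fact p.Prime] [NormedAlgebra ℚ_[p] K] in
/-- **THE BOX NORM IS SUBMULTIPLICATIVE**: if `‖π^i l_i‖ ≤ a` and `‖π^j m_j‖ ≤ b` for all `i, j`, then
`‖π^k (l ⋆ m)_k‖ ≤ a·b` for all `k` (each term has `‖π^k·p^{⌊(i+j)/e⌋}·l_i m_j‖ = ‖π^i l_i‖·‖π^j m_j‖` as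
`k + e⌊(i+j)/e⌋ = i + j`; ultrametric inequality). [cite: NeukirchANT1999, Ch. II (5.5)] -/
theorem norm_pi_pow_mul_conv_le [IsUltrametricDist K] (hπ : π ^ e = (p : K)) {l m : Fin e → K} {a b : ℝ}
    (ha : 0 ≤ a) (hb : 0 ≤ b) (hl : ∀ i : Fin e, ‖π ^ (i : ℕ) * l i‖ ≤ a) (hm : ∀ j : Fin e, ‖π ^ (j : ℕ) * m j‖ ≤ b)
    (k : Fin e) :
    ‖π ^ (k : ℕ) * ∑ x : Fin e × Fin e, (if ((x.1 : ℕ) + x.2) % e = (k : ℕ) then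
        (p : K) ^ (((x.1 : ℕ) + x.2) / e) * (l x.1 * m x.2) else 0)‖ ≤ a * b := by
  rw [Finset.mul_sum]
  refine IsUltrametricDist.norm_sum_le_of_forall_le_of_nonneg (mul_nonneg ha hb) fun x _ => ?_
  split_ifs with hx
  · rw [← hx, norm_pi_pow_mod_mul hπ, pow_add, mul_mul_mul_comm, norm_mul]
    exact mul_le_mul (hl x.1) (hm x.2) (norm_nonneg _) ha
  · rw [mul_zero, norm_zero]; exact mul_nonneg ha hb

/-! ## Boxes: the coordinate bounds are stable under sums, negation, scaling -/

omit [Fact p.Prime] [NormedAlgebra ℚ_[p] K] in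
/-- Box bounds add ultrametrically. [cite: NeukirchANT1999, Ch. II (5.5)] -/
theorem box_add [IsUltrametricDist K] {l l' : Fin e → K} {C : ℝ} (hl : ∀ k : Fin e, ‖π ^ (k : ℕ) * l k‖ ≤ C)
    (hl' : ∀ k : Fin e, ‖π ^ (k : ℕ) * l' k‖ ≤ C) (k : Fin e) : ‖π ^ (k : ℕ) * (l + l') k‖ ≤ C := by
  rw [Pi.add_apply, mul_add]
  exact (IsUltrametricDist.norm_add_le_max _ _).trans (max_le (hl k) (hl' k))

omit [Fact p.Prime] [NormedAlgebra ℚ_[p] K] in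
/-- Box bounds are stable under negation. [cite: NeukirchANT1999, Ch. II (5.5)] -/
theorem box_neg {l : Fin e → K} {C : ℝ} (hl : ∀ k : Fin e, ‖π ^ (k : ℕ) * l k‖ ≤ C) (k : Fin e) :
    ‖π ^ (k : ℕ) * (-l) k‖ ≤ C := by
  rw [Pi.neg_apply, mul_neg, norm_neg]; exact hl k

omit [Fact p.Prime] [NormedAlgebra ℚ_[p] K] in
/-- Box bounds are stable under finite sums (ultrametric). [cite: NeukirchANT1999, Ch. II (5.5)] -/
theorem box_finset_sum [IsUltrametricDist K] {ι : Type*} (s : Finset ι) {f : ι → Fin e → K} {C : ℝ} (hC : 0 ≤ C)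
    (hf : ∀ x ∈ s, ∀ k : Fin e, ‖π ^ (k : ℕ) * f x k‖ ≤ C) (k : Fin e) :
    ‖π ^ (k : ℕ) * (∑ x ∈ s, f x) k‖ ≤ C := by
  rw [Finset.sum_apply, Finset.mul_sum]
  exact IsUltrametricDist.norm_sum_le_of_forall_le_of_nonneg hC fun x hx => hf x hx k

omit [Fact p.Prime] [NormedAlgebra ℚ_[p] K] in
/-- Scaling a box by `c ∈ K`: `‖π^k·(c l_k)‖ = ‖c‖·‖π^k l_k‖`. [cite: NeukirchANT1999, Ch. II (5.5)] -/
theorem norm_pi_pow_mul_mul (c : K) (l : Fin e → K) (k : Fin e) :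
    ‖π ^ (k : ℕ) * (c * l k)‖ = ‖c‖ * ‖π ^ (k : ℕ) * l k‖ := by
  rw [mul_left_comm, norm_mul]

omit [Fact p.Prime] [NormedAlgebra ℚ_[p] K] in
/-- The single monomial `δ_{jk}·w` has the box bound of `‖π^k w‖`. [cite: NeukirchANT1999, Ch. II (5.5)] -/
theorem box_single {k : Fin e} {w : K} {C : ℝ} (hC : 0 ≤ C) (hw : ‖π ^ (k : ℕ) * w‖ ≤ C) (j : Fin e) :
    ‖π ^ (j : ℕ) * (if j = k then w else 0)‖ ≤ C := by
  split_ifs with h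
  · rw [h]; exact hw
  · rw [mul_zero, norm_zero]; exact hC

omit [Fact p.Prime] [NormedAlgebra ℚ_[p] K] in
/-- The unit vector `δ_{k0}` lies in the unit box. [cite: NeukirchANT1999, Ch. II (5.5)] -/
theorem box_delta (he : 0 < e) (j : Fin e) : ‖π ^ (j : ℕ) * (if j = ⟨0, he⟩ then (1 : K) else 0)‖ ≤ 1 := by
  refine box_single zero_le_one ?_ j
  show ‖π ^ 0 * (1 : K)‖ ≤ 1
  rw [pow_zero, mul_one, norm_one]

/-! ## Powers stay in boxes -/

/-- **Powers**: if `‖π^k l_k‖ ≤ M` for all `k`, then `(Σ_k π^k ⊗ l_k)^n = Σ_k π^k ⊗ l⁽ⁿ⁾_k` with `‖π^k l⁽ⁿ⁾_k‖ ≤ M^n`.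
[cite: Mochizuki2012, IUTchIV Prop. 1.1 p. 9] [cite: NeukirchANT1999, Ch. II (5.5)] -/
theorem exists_box_repr_pow [IsUltrametricDist K] (he : 0 < e) (hπ : π ^ e = (p : K)) {l : Fin e → K} {M : ℝ}
    (hM : 0 ≤ M) (hl : ∀ k : Fin e, ‖π ^ (k : ℕ) * l k‖ ≤ M) (n : ℕ) :
    ∃ c : Fin e → K, (∀ k : Fin e, ‖π ^ (k : ℕ) * c k‖ ≤ M ^ n) ∧
      (∑ k : Fin e, purePacket p (fun _ : Fin 2 => K) ![π ^ (k : ℕ), l k]) ^ n =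
        ∑ k : Fin e, purePacket p (fun _ : Fin 2 => K) ![π ^ (k : ℕ), c k] := by
  induction n with
  | zero =>
    refine ⟨fun j => if j = ⟨0, he⟩ then 1 else 0, fun k => ?_, ?_⟩
    · rw [pow_zero]; exact box_delta he k
    · rw [pow_zero]; exact one_eq_sum_purePacket p he
  | succ n ih =>
    obtain ⟨c, hc, hcn⟩ := ih
    refine ⟨_, fun k => ?_, by rw [pow_succ, hcn, sum_purePacket_mul he hπ]⟩
    rw [pow_succ]
    exact norm_pi_pow_mul_conv_le hπ (pow_nonneg hM n) hM hc hl k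

/-! ## Coordinates are unique (`[K : ℚ_p] = e`) -/

/-- The coordinate functional `x ⊗ y ↦ x_i·y` (`x_i` the `i`-th coordinate of `x` in the basis `(π^k)`).
[cite: Mochizuki2012, IUTchIV Prop. 1.1 p. 9] -/
theorem exists_coordFunctional (B : Module.Basis (Fin e) ℚ_[p] K) (i : Fin e) :
    ∃ Q : PacketAlgebra p (fun _ : Fin 2 => K) →ₗ[ℚ_[p]] K,
      ∀ x y : K, Q (purePacket p (fun _ : Fin 2 => K) ![x, y]) = B.repr x i • y := by
  refine ⟨PiTensorProduct.lift ((MultilinearMap.mkPiAlgebra ℚ_[p] (Fin 2) K).compLinearMap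
      (![(Algebra.linearMap ℚ_[p] K) ∘ₗ (B.coord i), LinearMap.id] : ∀ _ : Fin 2, K →ₗ[ℚ_[p]] K)), fun x y => ?_⟩
  rw [purePacket, PiTensorProduct.lift.tprod, MultilinearMap.compLinearMap_apply, MultilinearMap.mkPiAlgebra_apply,
    Fin.prod_univ_two, Algebra.smul_def]
  rfl

/-- The `i`-th coordinate of `Σ_k π^k ⊗ l_k` is `l_i`. [cite: Mochizuki2012, IUTchIV Prop. 1.1 p. 9] -/
theorem coordFunctional_sum_purePacket {B : Module.Basis (Fin e) ℚ_[p] K} (hB : ∀ k, B k = π ^ (k : ℕ)) {i : Fin e}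
    {Q : PacketAlgebra p (fun _ : Fin 2 => K) →ₗ[ℚ_[p]] K}
    (hQ : ∀ x y : K, Q (purePacket p (fun _ : Fin 2 => K) ![x, y]) = B.repr x i • y) (l : Fin e → K) :
    Q (∑ k : Fin e, purePacket p (fun _ : Fin 2 => K) ![π ^ (k : ℕ), l k]) = l i := by
  classical
  rw [map_sum, Finset.sum_eq_single i]
  · rw [hQ, repr_pi_pow B hB, if_pos rfl, one_smul]
  · intro k _ hk; rw [hQ, repr_pi_pow B hB, if_neg hk, zero_smul]
  · intro h; exact absurd (Finset.mem_univ _) h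

/-- **UNIQUENESS OF COORDINATES**: `Σ_k π^k ⊗ l_k = Σ_k π^k ⊗ l'_k ⇒ l = l'` (`[K : ℚ_p] = e`).
[cite: Mochizuki2012, IUTchIV Prop. 1.1 p. 9] [cite: NeukirchANT1999, Ch. II (5.5)] -/
theorem eq_of_sum_purePacket_eq [IsUltrametricDist K] (he : 0 < e) (hK : Module.finrank ℚ_[p] K = e)
    (hπ : π ^ e = (p : K)) {l l' : Fin e → K}
    (h : ∑ k : Fin e, purePacket p (fun _ : Fin 2 => K) ![π ^ (k : ℕ), l k] =
      ∑ k : Fin e, purePacket p (fun _ : Fin 2 => K) ![π ^ (k : ℕ), l' k]) : l = l' := by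
  obtain ⟨B, hB⟩ := exists_basis he hK hπ
  funext i
  obtain ⟨Q, hQ⟩ := exists_coordFunctional (p := p) B i
  have h1 := congrArg Q h
  rwa [coordFunctional_sum_purePacket hB hQ, coordFunctional_sum_purePacket hB hQ] at h1

/-! ## `R_I` lies in the unit box -/

/-- A pure tensor of integers is `Σ_k π^k ⊗ l_k` with all `‖π^k l_k‖ ≤ 1` (expand the left slot in the basis `(π^k)`:
`‖x_k‖·‖π‖^k ≤ ‖x‖ ≤ 1`). [cite: Mochizuki2012, IUTchIV Prop. 1.1 p. 9] [cite: NeukirchANT1999, Ch. II (5.5)] -/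
theorem exists_box_repr_purePacket [IsUltrametricDist K] (he : 0 < e) (hK : Module.finrank ℚ_[p] K = e)
    (hπ : π ^ e = (p : K)) {x : Fin 2 → K} (hx : ∀ i, ‖x i‖ ≤ 1) :
    ∃ l : Fin e → K, (∀ k : Fin e, ‖π ^ (k : ℕ) * l k‖ ≤ 1) ∧
      purePacket p (fun _ : Fin 2 => K) x = ∑ k : Fin e, purePacket p (fun _ : Fin 2 => K) ![π ^ (k : ℕ), l k] := by
  obtain ⟨B, hB⟩ := exists_basis he hK hπ
  have hx' : purePacket p (fun _ : Fin 2 => K) x = purePacket p (fun _ : Fin 2 => K) ![x 0, x 1] := by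
    congr 1; funext i; fin_cases i <;> rfl
  refine ⟨fun k => B.repr (x 0) k • x 1, fun k => ?_, ?_⟩
  · rw [mul_smul_comm, norm_smul, norm_mul, norm_pow, ← mul_assoc]
    calc ‖B.repr (x 0) k‖ * ‖π‖ ^ (k : ℕ) * ‖x 1‖ ≤ ‖x 0‖ * ‖x 1‖ :=
          mul_le_mul_of_nonneg_right (norm_repr_mul_le B hπ hB (x 0) k) (norm_nonneg _)
      _ ≤ 1 := mul_le_one₀ (hx 0) (norm_nonneg _) (hx 1)
  · rw [hx']
    conv_lhs => rw [← sum_repr B hB (x 0)]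
    rw [purePacket_pair_sum_left p]
    exact Finset.sum_congr rfl fun k _ => by rw [TameQuadratic.purePacket_pair_smul_left]

/-- **`R_I = 𝒪_K ⊗_{ℤ_p} 𝒪_K` LIES IN THE UNIT BOX** (any `p`, any `e ≥ 1`, `[K : ℚ_p] = e`): every `t ∈ R_I` is
`Σ_k π^k ⊗ l_k` with `‖π^k l_k‖ ≤ 1` for all `k`. [cite: Mochizuki2012, IUTchIV Prop. 1.1 p. 9] -/
theorem exists_box_repr_of_mem_integerPacket [IsUltrametricDist K] (he : 0 < e) (hK : Module.finrank ℚ_[p] K = e)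
    (hπ : π ^ e = (p : K)) {t : PacketAlgebra p (fun _ : Fin 2 => K)}
    (ht : t ∈ integerPacket p (fun _ : Fin 2 => K)) :
    ∃ l : Fin e → K, (∀ k : Fin e, ‖π ^ (k : ℕ) * l k‖ ≤ 1) ∧
      t = ∑ k : Fin e, purePacket p (fun _ : Fin 2 => K) ![π ^ (k : ℕ), l k] := by
  refine integerPacket_induction p (fun _ : Fin 2 => K) (C := fun t => ∃ l : Fin e → K,
      (∀ k : Fin e, ‖π ^ (k : ℕ) * l k‖ ≤ 1) ∧
        t = ∑ k : Fin e, purePacket p (fun _ : Fin 2 => K) ![π ^ (k : ℕ), l k]) ?_ ?_ ?_ ?_ ht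
  · intro x hx
    obtain ⟨l, hl, hlx⟩ := exists_box_repr_purePacket he hK hπ hx
    exact ⟨l, hl, hlx⟩
  · exact ⟨0, fun k => by rw [Pi.zero_apply, mul_zero, norm_zero]; exact zero_le_one,
      (sum_purePacket_zero p).symm⟩
  · rintro _ _ ⟨l, hl, rfl⟩ ⟨l', hl', rfl⟩
    exact ⟨l + l', box_add hl hl', (sum_purePacket_add p l l').symm⟩
  · rintro _ ⟨l, hl, rfl⟩
    exact ⟨-l, box_neg hl, (sum_purePacket_neg p l).symm⟩

end TameRadical

end Literature.IUT.LogVolume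

end

-- tree-health (abc-iut-w6-d081 g5, 2026-08-26T22:5xZ): comment-only re-land of a SKIPPED ACCEPT (committed 21:49–21:55Z; no hub olean after ≥ 55 min while the lane p90 ≈ 6 min; serial farm import probe rc 75 «remote:stale:unbuilt»);
-- declarations byte-identical to the accepted version; purpose = trigger the rebuild. No content change.
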